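import Literature.AlgebraicGeometry.Smoothening.NeronDefect
import Mathlib.RingTheory.DiscreteValuationRing.Basic
import Mathlib.RingTheory.Length
import Mathlib.Algebra.Module.Torsion.Basic
import Mathlib.LinearAlgebra.TensorProduct.Quotient
import Mathlib.LinearAlgebra.Dimension.Localization
import Mathlib.LinearAlgebra.Dimension.Torsion.Finite
import Mathlib.LinearAlgebra.FreeModule.PID
import Mathlib.LinearAlgebra.FreeModule.StrongRankCondition
import Mathlib.LinearAlgebra.Dimension.RankNullity
import Mathlib.LinearAlgebra.Isomorphisms
import Mathlib.RingTheory.LocalRing.ResidueField.Basic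
import Mathlib.RingTheory.TensorProduct.Finite
import HarnessLib

/-!
# The torsion drop under a dilatation: length bookkeeping over a discrete valuation ring

Topic: `Literature/AlgebraicGeometry/Smoothening` (Bosch–Lütkebohmert–Raynaud, *Néron Models*,
§3.3, proof of Prop. 3.3/5; M. Artin, *Néron Models*, Lemma (3.9) (Raynaud): "`l(x₁') < l(x')`",
i.e. Néron's measure for the defect of smoothness drops after blowing up a suitable centre in
the special fibre).

This file isolates the module-theoretic core of that computation. Let `S` be a discrete
valuation ring with uniformizer `π`. For a submodule `L` of a finite `S`-module `F` write
`τ(L) = length (torsion (F ⧸ L))` (in the application `F ⧸ L = a*Ω¹_{X/R}` is the pull-back of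
the differentials of an affine `R`-scheme `X ⊂ 𝔸ᴺ` along an `S`-valued point `a`, presented by
the conormal images `L` of the equations of `X`, and `τ(L) = δ(a)` is Néron's measure for the
defect of smoothness). Let `D : F → F'` be an injective map of finite modules, `F'` torsion-free
(equivalently free), with
`π F' ⊆ D(F)` (in the application: the differential of the dilatation at the lifted point `a'`),
and let `L' = ⟨v₁, …, v_p⟩ + ⟨s₂⟩ ⊆ F'` be such that `π vᵢ ∈ D(L)`, `π² x ∈ D(L)` for `x ∈ s₂`,
and `D(L) ⊆ π ⟨v⟩ + π² ⟨s₂⟩` (in the application: the conormal images at `a'` of the equations of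
`X` divided once, resp. twice, by `π` on the dilatation). Then

  `τ(L') + rank L ≤ τ(L) + p`            (`length_torsion_quotient_add_finrank_le`),

so `τ(L') ≤ τ(L) - 1` as soon as fewer than `rank L` once-divided equations are needed — which
is what the choice of the centre in BLR 3.3/4–5 guarantees when `X` is not smooth at `a`.

The proof is the chain `τ(D L) = τ(L) + τ(D L^sat) ≤ τ(L) + rank L` (the torsion of
`F' ⧸ D(L^sat)` is killed by `π` and is a quotient of a free module of rank `rank L`),
`τ(D L) = length (L' ⧸ D L) + τ(L')` (`L' ⧸ D L` is torsion), and
`length (L' ⧸ D L) ≥ length (L' ⧸ (π L'₁ + π² L'₂)) = rank L' + length (L' ⧸ (L'₁ + π L'₂))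
 ≥ 2 rank L' - p`.

Everything here is elementary commutative algebra ([folklore]); only the packaging is dictated
by the smoothening argument (`length_torsion_eq` from `NeronDefect` transports torsion lengths
along isomorphisms). No named facts are introduced (D-0026).

## References

* S. Bosch, W. Lütkebohmert, M. Raynaud, *Néron Models*, Springer 1990, §3.3, Prop. 5.
  [BLRNeronModels1990] (Not held; number only.)
* M. Artin, *Néron Models*, in: G. Cornell, J. H. Silverman (eds.), *Arithmetic Geometry*,
  Springer 1986, Lemma (3.9) and its proof, steps (e)–(f) (pp. 226–227). [Artin1986NeronModels]
-/

open scoped Pointwise TensorProduct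
open Module Submodule

namespace Literature.AlgebraicGeometry.Smoothening

universe u v v' w

section General

variable {S : Type u} [CommRing S] {M : Type v} [AddCommGroup M] [Module S M]

/-- For submodules `A ≤ B` of `M`: `ℓ(M/A) = ℓ(B/A) + ℓ(M/B)`, with `B/A = B.map A.mkQ`.
[folklore] -/
theorem length_quotient_eq_add (A B : Submodule S M) (h : A ≤ B) :
    Module.length S (M ⧸ A) = Module.length S (B.map A.mkQ) + Module.length S (M ⧸ B) := by
  rw [Module.length_eq_add_of_exact (B.map A.mkQ).subtype (B.map A.mkQ).mkQ
      (Submodule.injective_subtype _) (Submodule.mkQ_surjective _) (LinearMap.exact_subtype_mkQ _),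
    (Submodule.quotientQuotientEquivQuotient A B h).length_eq]

/-- `ℓ(B.map A.mkQ) = ℓ(B ⧸ (A ∩ B))`. [folklore] -/
theorem length_map_mkQ (A B : Submodule S M) :
    Module.length S (B.map A.mkQ) = Module.length S (B ⧸ A.comap B.subtype) := by
  let φ : B →ₗ[S] M ⧸ A := A.mkQ.comp B.subtype
  have hker : LinearMap.ker φ = A.comap B.subtype := by
    rw [LinearMap.ker_comp, Submodule.ker_mkQ]
  have hrange : LinearMap.range φ = B.map A.mkQ := by
    rw [LinearMap.range_comp, Submodule.range_subtype]
  rw [← (LinearEquiv.ofEq _ _ hrange).length_eq, ← (LinearMap.quotKerEquivRange φ).length_eq,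
    (Submodule.quotEquivOfEq _ _ hker).length_eq]

/-- The torsion of `Q ⧸ T₀` for a torsion submodule `T₀`: `ℓ(tors Q) = ℓ(T₀) + ℓ(tors (Q ⧸ T₀))`.
[folklore] -/
theorem length_torsion_eq_add_of_le_torsion {Q : Type v} [AddCommGroup Q] [Module S Q]
    (T₀ : Submodule S Q) (hT₀ : T₀ ≤ torsion S Q) :
    Module.length S (torsion S Q) =
      Module.length S T₀ + Module.length S (torsion S (Q ⧸ T₀)) := by
  have hmaps : ∀ x ∈ torsion S Q, T₀.mkQ x ∈ torsion S (Q ⧸ T₀) := by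
    intro x hx
    obtain ⟨c, hc⟩ := (mem_torsion_iff x).mp hx
    refine (mem_torsion_iff _).mpr ⟨c, ?_⟩
    rw [Submonoid.smul_def, ← map_smul, ← Submonoid.smul_def, hc, map_zero]
  let g : torsion S Q →ₗ[S] torsion S (Q ⧸ T₀) := (T₀.mkQ).restrict hmaps
  have hg : Function.Surjective g := by
    rintro ⟨z, hz⟩
    obtain ⟨y, rfl⟩ := Submodule.mkQ_surjective T₀ z
    obtain ⟨c, hc⟩ := (mem_torsion_iff _).mp hz
    rw [Submonoid.smul_def, ← map_smul, Submodule.mkQ_apply, Submodule.Quotient.mk_eq_zero] at hc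
    obtain ⟨c', hc'⟩ := (mem_torsion_iff _).mp (hT₀ hc)
    have hy : y ∈ torsion S Q := by
      refine (mem_torsion_iff y).mpr ⟨c' * c, ?_⟩
      rw [Submonoid.smul_def, Submonoid.coe_mul, mul_smul, ← Submonoid.smul_def, hc']
    exact ⟨⟨y, hy⟩, Subtype.ext rfl⟩
  have hexact : Function.Exact (Submodule.inclusion hT₀) g := by
    intro x
    constructor
    · intro hx
      have hx' : (T₀.mkQ x : Q ⧸ T₀) = 0 := congrArg Subtype.val hx
      rw [Submodule.mkQ_apply, Submodule.Quotient.mk_eq_zero] at hx'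
      exact ⟨⟨x, hx'⟩, Subtype.ext rfl⟩
    · rintro ⟨y, rfl⟩
      apply Subtype.ext
      change T₀.mkQ (y : Q) = 0
      rw [Submodule.mkQ_apply, Submodule.Quotient.mk_eq_zero]
      exact y.2
  exact Module.length_eq_add_of_exact (Submodule.inclusion hT₀) g
    (Submodule.inclusion_injective hT₀) hg hexact

/-- If `N₁ ≤ N₂` and `N₂/N₁` is torsion, then
`ℓ(tors (M ⧸ N₁)) = ℓ(N₂/N₁) + ℓ(tors (M ⧸ N₂))`. [folklore] -/
theorem length_torsion_quotient_eq_add (N₁ N₂ : Submodule S M) (h : N₁ ≤ N₂)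
    (htors : ∀ x ∈ N₂, ∃ c ∈ nonZeroDivisors S, c • x ∈ N₁) :
    Module.length S (torsion S (M ⧸ N₁)) =
      Module.length S (N₂.map N₁.mkQ) + Module.length S (torsion S (M ⧸ N₂)) := by
  have hT₀ : N₂.map N₁.mkQ ≤ torsion S (M ⧸ N₁) := by
    rintro _ ⟨x, hx, rfl⟩
    obtain ⟨c, hc, hcx⟩ := htors x hx
    refine (mem_torsion_iff _).mpr ⟨⟨c, hc⟩, ?_⟩
    rw [Submonoid.smul_def, ← map_smul, Submodule.mkQ_apply, Submodule.Quotient.mk_eq_zero]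
    exact hcx
  rw [length_torsion_eq_add_of_le_torsion _ hT₀,
    length_torsion_eq (Submodule.quotientQuotientEquivQuotient N₁ N₂ h)]

/-- Submodules `A ≤ B` with `B/A` torsion have the same rank (`B` finitely generated, `S` a
domain). [folklore] -/
theorem finrank_eq_of_le_of_torsion [IsDomain S] (A B : Submodule S M) (h : A ≤ B)
    [Module.Finite S B] (htors : ∀ x ∈ B, ∃ c ∈ nonZeroDivisors S, c • x ∈ A) :
    Module.finrank S A = Module.finrank S B := by
  have h1 := Submodule.finrank_quotient_add_finrank (A.comap B.subtype)
  have h2 : Module.finrank S (A.comap B.subtype) = Module.finrank S A :=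
    (Submodule.comapSubtypeEquivOfLe h).finrank_eq
  have h3 : Module.finrank S (B ⧸ A.comap B.subtype) = 0 := by
    refine Module.finrank_eq_zero_iff_isTorsion.mpr ?_
    intro z
    obtain ⟨x, rfl⟩ := Submodule.mkQ_surjective _ z
    obtain ⟨c, hc, hcx⟩ := htors x x.2
    refine ⟨⟨c, hc⟩, ?_⟩
    rw [Submonoid.smul_def, ← map_smul, Submodule.mkQ_apply, Submodule.Quotient.mk_eq_zero]
    exact hcx
  omega

end General

/-! ### Over a discrete valuation ring -/

section DVR

variable {S : Type u} [CommRing S] [IsDomain S] [IsDiscreteValuationRing S] {π : S}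

/-- `ℓ(X/πX) = rank X` for a finite free module `X` over a discrete valuation ring with
uniformizer `π`. [folklore] -/
theorem length_quotient_smul_top_eq_finrank (hπ : Irreducible π) (X : Type v) [AddCommGroup X]
    [Module S X] [Module.Free S X] [Module.Finite S X] :
    Module.length S (X ⧸ (π • ⊤ : Submodule S X)) = Module.finrank S X := by
  have hsmul : (π • ⊤ : Submodule S X) = IsLocalRing.maximalIdeal S • ⊤ := by
    rw [hπ.maximalIdeal_eq, Submodule.ideal_span_singleton_smul]
  rw [(Submodule.quotEquivOfEq _ _ hsmul).length_eq,
    ← (TensorProduct.quotTensorEquivQuotSMul X (IsLocalRing.maximalIdeal S)).length_eq]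
  change Module.length S (IsLocalRing.ResidueField S ⊗[S] X) = _
  rw [Module.length_eq_of_surjective (R := IsLocalRing.ResidueField S)
      (M := IsLocalRing.ResidueField S ⊗[S] X) IsLocalRing.residue_surjective,
    Module.length_eq_finrank, Module.finrank_baseChange]

/-- In a module killed by `π`, a submodule spanned by a finite family has length at most the
size of the family. [folklore] -/
theorem length_span_le_card (hπ : Irreducible π) {Y : Type v} [AddCommGroup Y] [Module S Y]
    (hY : ∀ y : Y, π • y = 0) {ι : Type w} [Fintype ι] (y : ι → Y) :
    Module.length S (span S (Set.range y)) ≤ Fintype.card ι := by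
  classical
  let Φ : (ι → S) →ₗ[S] Y := Fintype.linearCombination S y
  have hker : (π • ⊤ : Submodule S (ι → S)) ≤ LinearMap.ker Φ := by
    rintro _ ⟨f, -, rfl⟩
    change Φ (π • f) = 0
    rw [map_smul, hY]
  have hrange : LinearMap.range ((π • ⊤ : Submodule S (ι → S)).liftQ Φ hker) =
      span S (Set.range y) := by
    rw [Submodule.range_liftQ]; exact Fintype.range_linearCombination S y
  rw [← (LinearEquiv.ofEq _ _ hrange).length_eq]
  refine (Module.length_le_of_surjective (LinearMap.rangeRestrict _)
    (LinearMap.surjective_rangeRestrict _)).trans ?_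
  rw [length_quotient_smul_top_eq_finrank hπ, Module.finrank_fintype_fun_eq_card]

/-- Over a discrete valuation ring with uniformizer `π`: if `A, W` are submodules of a finite
torsion-free module `F'` with `π W ≤ A`, then `ℓ(W/(A ∩ W)) ≤ rank W`. [folklore] -/
theorem length_quotient_le_finrank_of_smul_le (hπ : Irreducible π) {F' : Type v}
    [AddCommGroup F'] [Module S F'] [Module.IsTorsionFree S F'] [Module.Finite S F']
    (A W : Submodule S F') (hπW : ∀ w ∈ W, π • w ∈ A) :
    Module.length S (W.map A.mkQ) ≤ Module.finrank S W := by
  rw [length_map_mkQ, ← length_quotient_smul_top_eq_finrank hπ W]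
  have hle : (π • ⊤ : Submodule S W) ≤ A.comap W.subtype := by
    rintro _ ⟨w, -, rfl⟩
    exact hπW w w.2
  exact Module.length_le_of_surjective (Submodule.factor hle) (Submodule.factor_surjective hle)

end DVR

/-! ### The main inequality -/

section Main

variable {S : Type u} [CommRing S] [IsDomain S] [IsDiscreteValuationRing S] {π : S}
  {F : Type v} [AddCommGroup F] [Module S F] [Module.Finite S F]
  {F' : Type v'} [AddCommGroup F'] [Module S F'] [Module.IsTorsionFree S F'] [Module.Finite S F']

/-- **Step 1.** For an injective `D : F → F'` into a finite torsion-free module with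
`π F' ⊆ D(F)` and a submodule `L ⊆ F`: `ℓ(tors (F' ⧸ D L)) ≤ ℓ(tors (F ⧸ L)) + rank L`.
[folklore] -/
theorem length_torsion_quotient_map_le (hπ : Irreducible π) (D : F →ₗ[S] F')
    (hD : Function.Injective D) (hDπ : ∀ y : F', ∃ x : F, D x = π • y) (L : Submodule S F) :
    Module.length S (torsion S (F' ⧸ L.map D)) ≤
      Module.length S (torsion S (F ⧸ L)) + Module.finrank S L := by
  have hπ0 : π ∈ nonZeroDivisors S := mem_nonZeroDivisors_of_ne_zero hπ.ne_zero
  -- the saturation of `L`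
  let Lsat : Submodule S F := (torsion S (F ⧸ L)).comap L.mkQ
  have hmemLsat : ∀ x, x ∈ Lsat ↔ ∃ c ∈ nonZeroDivisors S, c • x ∈ L := by
    intro x
    simp only [Lsat, Submodule.mem_comap, mem_torsion_iff, Submodule.mkQ_apply]
    constructor
    · rintro ⟨c, hc⟩
      refine ⟨c, c.2, ?_⟩
      rwa [Submonoid.smul_def, ← Submodule.Quotient.mk_smul, Submodule.Quotient.mk_eq_zero] at hc
    · rintro ⟨c, hc, hcx⟩
      refine ⟨⟨c, hc⟩, ?_⟩
      rwa [Submonoid.smul_def, ← Submodule.Quotient.mk_smul, Submodule.Quotient.mk_eq_zero]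
  have hLLsat : L ≤ Lsat := fun x hx =>
    (hmemLsat x).mpr ⟨1, Submonoid.one_mem _, by rwa [one_smul]⟩
  have hsatL : ∀ x ∈ Lsat, ∃ c ∈ nonZeroDivisors S, c • x ∈ L := fun x hx => (hmemLsat x).mp hx
  -- (i) `τ(DL) = ℓ(D Lsat / D L) + τ(D Lsat)`
  have hB := length_torsion_quotient_eq_add (L.map D) (Lsat.map D) (Submodule.map_mono hLLsat)
    (by
      rintro _ ⟨x, hx, rfl⟩
      obtain ⟨c, hc, hcx⟩ := hsatL x hx
      exact ⟨c, hc, by rw [← map_smul]; exact Submodule.mem_map_of_mem hcx⟩)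
  -- (ii) `ℓ(D Lsat / D L) = ℓ(Lsat / L) = τ(L)`
  have hiso : Module.length S ((Lsat.map D).map (L.map D).mkQ) =
      Module.length S (torsion S (F ⧸ L)) := by
    have hLsat_map : Lsat.map L.mkQ = torsion S (F ⧸ L) :=
      Submodule.map_comap_eq_of_surjective (Submodule.mkQ_surjective L) _
    rw [← hLsat_map, length_map_mkQ, length_map_mkQ]
    let e₀ : Lsat ≃ₗ[S] (Lsat.map D) := Submodule.equivMapOfInjective D hD Lsat
    refine (Submodule.Quotient.equiv _ _ e₀ ?_).length_eq.symm
    apply le_antisymm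
    · rintro _ ⟨x, hx, rfl⟩
      simp only [Submodule.mem_comap, Submodule.subtype_apply] at hx ⊢
      rw [LinearEquiv.coe_coe, Submodule.coe_equivMapOfInjective_apply]
      exact Submodule.mem_map_of_mem hx
    · rintro ⟨_, x, hx, rfl⟩ hy
      simp only [Submodule.mem_comap, Submodule.subtype_apply] at hy
      obtain ⟨x', hx', hxx'⟩ := hy
      obtain rfl : x = x' := (hD hxx').symm
      refine ⟨⟨x, hx⟩, ?_, ?_⟩
      · exact hx'
      · apply Subtype.ext
        rw [LinearEquiv.coe_coe, Submodule.coe_equivMapOfInjective_apply]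
  -- (iii) `τ(D Lsat) ≤ rank L`
  let W : Submodule S F' := (torsion S (F' ⧸ Lsat.map D)).comap (Lsat.map D).mkQ
  have hmemW : ∀ y, y ∈ W ↔ ∃ c ∈ nonZeroDivisors S, c • y ∈ Lsat.map D := by
    intro y
    simp only [W, Submodule.mem_comap, mem_torsion_iff, Submodule.mkQ_apply]
    constructor
    · rintro ⟨c, hc⟩
      refine ⟨c, c.2, ?_⟩
      rwa [Submonoid.smul_def, ← Submodule.Quotient.mk_smul, Submodule.Quotient.mk_eq_zero] at hc
    · rintro ⟨c, hc, hcx⟩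
      refine ⟨⟨c, hc⟩, ?_⟩
      rwa [Submonoid.smul_def, ← Submodule.Quotient.mk_smul, Submodule.Quotient.mk_eq_zero]
  have hW_map : W.map (Lsat.map D).mkQ = torsion S (F' ⧸ Lsat.map D) :=
    Submodule.map_comap_eq_of_surjective (Submodule.mkQ_surjective _) _
  have hDLsatW : Lsat.map D ≤ W := fun y hy =>
    (hmemW y).mpr ⟨1, Submonoid.one_mem _, by rwa [one_smul]⟩
  have hπW : ∀ w ∈ W, π • w ∈ Lsat.map D := by
    intro w hw
    obtain ⟨c, hc, hcw⟩ := (hmemW w).mp hw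
    obtain ⟨l, hl, hlw⟩ := hcw
    obtain ⟨c', hc', hc'l⟩ := hsatL l hl
    obtain ⟨x, hx⟩ := hDπ w
    refine ⟨x, (hmemLsat x).mpr ⟨c' * c, Submonoid.mul_mem _ hc' hc, ?_⟩, hx⟩
    have : D ((c' * c) • x) = D (π • c' • l) := by
      rw [map_smul, hx, map_smul, map_smul, hlw, smul_comm π c', ← mul_smul, ← mul_smul,
        ← mul_smul, mul_right_comm]
    rw [hD this]
    exact Submodule.smul_mem _ _ hc'l
  have hiii : Module.length S (torsion S (F' ⧸ Lsat.map D)) ≤ Module.finrank S L := by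
    rw [← hW_map]
    refine (length_quotient_le_finrank_of_smul_le hπ _ W hπW).trans (le_of_eq ?_)
    haveI : Module.Finite S W := Module.Finite.of_injective W.subtype W.injective_subtype
    haveI : Module.Finite S Lsat := Module.Finite.of_injective Lsat.subtype Lsat.injective_subtype
    rw [← finrank_eq_of_le_of_torsion (Lsat.map D) W hDLsatW (fun y hy => (hmemW y).mp hy),
      ← (Submodule.equivMapOfInjective D hD Lsat).finrank_eq,
      finrank_eq_of_le_of_torsion L Lsat hLLsat hsatL]
  rw [hB, hiso]
  exact add_le_add le_rfl (by exact_mod_cast hiii)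

/-- **The torsion drop** (the module-theoretic core of BLR Prop. 3.3/5 / Artin–Raynaud,
Lemma (3.9): "`p ∂g/∂z = ∂f/∂x`, which shows that `l` decreases by blowing-up"). Let `S` be a
discrete valuation ring with uniformizer `π`, `D : F → F'` an injective map of finite
`S`-modules, `F'` torsion-free (= free), with `π F' ⊆ D(F)`, `L ⊆ F` a submodule, and
`L' = ⟨v⟩ + ⟨s₂⟩ ⊆ F'` with
`π vᵢ ∈ D(L)`, `π² x ∈ D(L)` (`x ∈ s₂`) and `D(L) ⊆ π⟨v⟩ + π²⟨s₂⟩`. Then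
`ℓ(tors (F' ⧸ L')) + rank L ≤ ℓ(tors (F ⧸ L)) + #v`. [folklore] -/
theorem length_torsion_quotient_add_finrank_le (hπ : Irreducible π) (D : F →ₗ[S] F')
    (hD : Function.Injective D) (hDπ : ∀ y : F', ∃ x : F, D x = π • y) (L : Submodule S F)
    {ι : Type w} [Fintype ι] (v : ι → F') (s₂ : Set F')
    (h₁ : ∀ i, π • v i ∈ L.map D) (h₂ : ∀ x ∈ s₂, (π * π) • x ∈ L.map D)
    (hL : ∀ x ∈ L, ∃ y₁ ∈ span S (Set.range v), ∃ y₂ ∈ span S s₂,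
      D x = π • y₁ + (π * π) • y₂) :
    Module.length S (torsion S (F' ⧸ (span S (Set.range v) ⊔ span S s₂))) + Module.finrank S L
      ≤ Module.length S (torsion S (F ⧸ L)) + Fintype.card ι := by
  have hπ0 : π ∈ nonZeroDivisors S := mem_nonZeroDivisors_of_ne_zero hπ.ne_zero
  set L' : Submodule S F' := span S (Set.range v) ⊔ span S s₂ with hL'def
  set DL : Submodule S F' := L.map D with hDLdef
  -- `D L ≤ L'` and `L'/DL` is torsion
  have hDL_le : DL ≤ L' := by
    rintro _ ⟨x, hx, rfl⟩
    obtain ⟨y₁, hy₁, y₂, hy₂, h⟩ := hL x hx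
    rw [h]
    exact add_mem (Submodule.mem_sup_left (Submodule.smul_mem _ _ hy₁))
      (Submodule.mem_sup_right (Submodule.smul_mem _ _ hy₂))
  have htorsL' : ∀ x ∈ L', ∃ c ∈ nonZeroDivisors S, c • x ∈ DL := by
    let W : Submodule S F' := (torsion S (F' ⧸ DL)).comap DL.mkQ
    have hmemW : ∀ y, y ∈ W ↔ ∃ c ∈ nonZeroDivisors S, c • y ∈ DL := by
      intro y
      simp only [W, Submodule.mem_comap, mem_torsion_iff, Submodule.mkQ_apply]
      constructor
      · rintro ⟨c, hc⟩
        refine ⟨c, c.2, ?_⟩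
        rwa [Submonoid.smul_def, ← Submodule.Quotient.mk_smul, Submodule.Quotient.mk_eq_zero] at hc
      · rintro ⟨c, hc, hcx⟩
        refine ⟨⟨c, hc⟩, ?_⟩
        rwa [Submonoid.smul_def, ← Submodule.Quotient.mk_smul, Submodule.Quotient.mk_eq_zero]
    have hle : L' ≤ W := by
      refine sup_le (Submodule.span_le.mpr ?_) (Submodule.span_le.mpr ?_)
      · rintro _ ⟨i, rfl⟩
        exact (hmemW _).mpr ⟨π, hπ0, h₁ i⟩
      · intro x hx
        exact (hmemW _).mpr ⟨π * π, Submonoid.mul_mem _ hπ0 hπ0, h₂ x hx⟩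
    exact fun x hx => (hmemW x).mp (hle hx)
  -- Step 1 and Step 2
  have hstep1 := length_torsion_quotient_map_le hπ D hD hDπ L
  have hstep2 := length_torsion_quotient_eq_add DL L' hDL_le htorsL'
  -- ranks: `rank L' = rank L`
  haveI : Module.Finite S L' := Module.Finite.of_injective L'.subtype L'.injective_subtype
  have hrank : Module.finrank S L' = Module.finrank S L := by
    rw [← finrank_eq_of_le_of_torsion DL L' hDL_le htorsL', hDLdef,
      (Submodule.equivMapOfInjective D hD L).finrank_eq]
  -- Step 3: `ℓ(L'/DL) + #v ≥ 2 rank L`, computed inside the free module `X = L'`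
  have hstep3 : (Module.finrank S L : ℕ∞) + Module.finrank S L ≤
      Module.length S (L'.map DL.mkQ) + Fintype.card ι := by
    -- submodules of `X := ↥L'`
    let A₀ : Submodule S L' := DL.comap L'.subtype
    let X₁ : Submodule S L' := (span S (Set.range v)).comap L'.subtype
    let X₂ : Submodule S L' := (span S s₂).comap L'.subtype
    let V₁ : Submodule S L' := π • X₁ ⊔ (π * π) • X₂
    let V₂ : Submodule S L' := π • ⊤
    have hA₀V₁ : A₀ ≤ V₁ := by
      rintro ⟨y, hy⟩ hy'
      obtain ⟨x, hx, rfl⟩ := (Submodule.mem_comap.mp hy' : y ∈ DL)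
      obtain ⟨y₁, hy₁, y₂, hy₂, h⟩ := hL x hx
      have hy₁' : y₁ ∈ L' := Submodule.mem_sup_left hy₁
      have hy₂' : y₂ ∈ L' := Submodule.mem_sup_right hy₂
      have : (⟨D x, hy⟩ : L') = π • ⟨y₁, hy₁'⟩ + (π * π) • ⟨y₂, hy₂'⟩ := Subtype.ext h
      rw [this]
      exact add_mem
        (Submodule.mem_sup_left (Submodule.smul_mem_pointwise_smul _ _ _ (by exact hy₁)))
        (Submodule.mem_sup_right (Submodule.smul_mem_pointwise_smul _ _ _ (by exact hy₂)))
    have hV₁V₂ : V₁ ≤ V₂ := by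
      refine sup_le ?_ ?_
      · rintro _ ⟨x, -, rfl⟩
        exact Submodule.smul_mem_pointwise_smul _ _ _ Submodule.mem_top
      · rintro _ ⟨x, -, rfl⟩
        refine ⟨π • x, Submodule.mem_top, ?_⟩
        change π • π • x = (π * π) • x
        rw [mul_smul]
    -- `ℓ(L'/DL) = ℓ(X/A₀) ≥ ℓ(X/V₁) = ℓ(V₂/V₁) + ℓ(X/V₂)`
    have hXA₀ : Module.length S (L'.map DL.mkQ) = Module.length S (L' ⧸ A₀) := length_map_mkQ _ _
    have hXV₁ : Module.length S (L' ⧸ V₁) ≤ Module.length S (L' ⧸ A₀) :=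
      Module.length_le_of_surjective (Submodule.factor hA₀V₁) (Submodule.factor_surjective hA₀V₁)
    have hC := length_quotient_eq_add V₁ V₂ hV₁V₂
    have hXV₂ : Module.length S (L' ⧸ V₂) = Module.finrank S L :=
      (length_quotient_smul_top_eq_finrank hπ L').trans (by rw [hrank])
    -- `ℓ(V₂/V₁) ≥ ℓ(X/(X₁ + πX))`, via multiplication by `π`: `X ≃ V₂ = πX`
    have hreg : IsRegular π := IsRegular.of_ne_zero hπ.ne_zero
    have hinj : Function.Injective (π • LinearMap.id : L' →ₗ[S] L') :=
      fun a b hab => hreg.smul_right_injective L' (by simpa using hab)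
    have hrangeπ : LinearMap.range (π • LinearMap.id : L' →ₗ[S] L') = V₂ := by
      ext y
      simp only [LinearMap.mem_range, LinearMap.smul_apply, LinearMap.id_coe, id_eq, V₂,
        Submodule.mem_smul_pointwise_iff_exists, Submodule.mem_top, true_and]
    let e : L' ≃ₗ[S] V₂ := (LinearEquiv.ofInjective _ hinj).trans (LinearEquiv.ofEq _ _ hrangeπ)
    have he : ∀ x : L', ((e x : V₂) : L') = π • x := fun x => rfl
    let V₁' : Submodule S L' := (V₁.comap V₂.subtype).comap (e : L' →ₗ[S] V₂)
    have hV₂V₁ : Module.length S (V₂.map V₁.mkQ) = Module.length S (L' ⧸ V₁') := by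
      rw [length_map_mkQ]
      refine (Submodule.Quotient.equiv V₁' (V₁.comap V₂.subtype) e ?_).length_eq.symm
      exact Submodule.map_comap_eq_of_surjective e.surjective _
    have hV₁'le : V₁' ≤ X₁ ⊔ π • ⊤ := by
      intro x hx
      have hx' : π • x ∈ V₁ := by
        rw [← he]; exact hx
      obtain ⟨a, ha, b, hb, hab⟩ := Submodule.mem_sup.mp hx'
      obtain ⟨a', ha', rfl⟩ := (Submodule.mem_smul_pointwise_iff_exists _ _ _).mp ha
      obtain ⟨b', hb', rfl⟩ := (Submodule.mem_smul_pointwise_iff_exists _ _ _).mp hb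
      have hx_eq : x = a' + π • b' := by
        apply hreg.smul_right_injective L'
        simp only [smul_add, ← hab, mul_smul]
      rw [hx_eq]
      exact add_mem (Submodule.mem_sup_left ha')
        (Submodule.mem_sup_right (Submodule.smul_mem_pointwise_smul _ _ _ Submodule.mem_top))
    have hV₁'len : Module.length S (L' ⧸ (X₁ ⊔ π • ⊤)) ≤ Module.length S (L' ⧸ V₁') :=
      Module.length_le_of_surjective (Submodule.factor hV₁'le) (Submodule.factor_surjective hV₁'le)
    -- `ℓ(X/(X₁ + πX)) + ℓ((X₁ + πX)/πX) = ℓ(X/πX) = rank L` and `ℓ((X₁ + πX)/πX) ≤ #v`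
    have hC' := length_quotient_eq_add (π • ⊤ : Submodule S L') (X₁ ⊔ π • ⊤) le_sup_right
    have htop : Module.length S (L' ⧸ (π • ⊤ : Submodule S L')) = Module.finrank S L :=
      (length_quotient_smul_top_eq_finrank hπ L').trans (by rw [hrank])
    have hX₁ : Module.length S ((X₁ ⊔ π • ⊤).map (π • ⊤ : Submodule S L').mkQ) ≤
        Fintype.card ι := by
      rw [Submodule.map_sup, Submodule.mkQ_map_self, sup_bot_eq]
      -- `X₁ ≤ span (range v')` with `v' i = ⟨v i, _⟩`
      let v' : ι → L' := fun i => ⟨v i, Submodule.mem_sup_left (Submodule.subset_span ⟨i, rfl⟩)⟩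
      have hX₁le : X₁ ≤ span S (Set.range v') := by
        rintro ⟨y, hy⟩ hy'
        have hy'' : y ∈ span S (Set.range v) := hy'
        have hmap : (span S (Set.range v')).map L'.subtype = span S (Set.range v) := by
          rw [Submodule.map_span, ← Set.range_comp]; rfl
        rw [← hmap] at hy''
        obtain ⟨z, hz, hzy⟩ := hy''
        have : (⟨y, hy⟩ : L') = z := Subtype.ext hzy.symm
        rwa [this]
      have hmono : Module.length S (X₁.map (π • ⊤ : Submodule S L').mkQ) ≤
          Module.length S ((span S (Set.range v')).map (π • ⊤ : Submodule S L').mkQ) :=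
        Module.length_le_of_injective (Submodule.inclusion (Submodule.map_mono hX₁le))
          (Submodule.inclusion_injective _)
      refine hmono.trans ?_
      rw [Submodule.map_span, ← Set.range_comp]
      refine length_span_le_card hπ (fun z => ?_) _
      obtain ⟨z, rfl⟩ := Submodule.mkQ_surjective _ z
      rw [Submodule.mkQ_apply, ← Submodule.Quotient.mk_smul, Submodule.Quotient.mk_eq_zero]
      exact Submodule.smul_mem_pointwise_smul _ _ _ Submodule.mem_top
    -- assemble
    have e1 : (Module.finrank S L : ℕ∞) =
        Module.length S ((X₁ ⊔ π • ⊤).map (π • ⊤ : Submodule S L').mkQ) +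
          Module.length S (L' ⧸ (X₁ ⊔ π • ⊤)) := htop.symm.trans hC'
    have e4 : Module.length S (L' ⧸ V₁) =
        Module.length S (V₂.map V₁.mkQ) + Module.finrank S L := hC.trans (by rw [hXV₂])
    have e5 : Module.length S (L' ⧸ V₁) ≤ Module.length S (L'.map DL.mkQ) := hXA₀ ▸ hXV₁
    calc (Module.finrank S L : ℕ∞) + Module.finrank S L
        = Module.length S ((X₁ ⊔ π • ⊤).map (π • ⊤ : Submodule S L').mkQ) +
            Module.length S (L' ⧸ (X₁ ⊔ π • ⊤)) + Module.finrank S L := by rw [← e1]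
      _ ≤ Fintype.card ι + Module.length S (L' ⧸ V₁') + Module.finrank S L :=
          add_le_add (add_le_add hX₁ hV₁'len) le_rfl
      _ = Fintype.card ι + (Module.length S (V₂.map V₁.mkQ) + Module.finrank S L) := by
          rw [hV₂V₁, add_assoc]
      _ = Fintype.card ι + Module.length S (L' ⧸ V₁) := by rw [e4]
      _ ≤ Fintype.card ι + Module.length S (L'.map DL.mkQ) := add_le_add le_rfl e5
      _ = Module.length S (L'.map DL.mkQ) + Fintype.card ι := add_comm _ _
  -- conclusion
  have hfin : (Module.finrank S L : ℕ∞) ≠ ⊤ := ENat.coe_ne_top _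
  have key : Module.length S (torsion S (F' ⧸ L')) + Module.finrank S L + Module.finrank S L ≤
      Module.length S (torsion S (F ⧸ L)) + Fintype.card ι + Module.finrank S L := by
    calc Module.length S (torsion S (F' ⧸ L')) + Module.finrank S L + Module.finrank S L
        = Module.length S (torsion S (F' ⧸ L')) + (Module.finrank S L + Module.finrank S L) := by
          rw [add_assoc]
      _ ≤ Module.length S (torsion S (F' ⧸ L')) +
            (Module.length S (L'.map DL.mkQ) + Fintype.card ι) := add_le_add le_rfl hstep3
      _ = Module.length S (torsion S (F' ⧸ DL)) + Fintype.card ι := by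
          rw [hstep2]; ring
      _ ≤ Module.length S (torsion S (F ⧸ L)) + Module.finrank S L + Fintype.card ι :=
          add_le_add hstep1 le_rfl
      _ = Module.length S (torsion S (F ⧸ L)) + Fintype.card ι + Module.finrank S L := by ring
  exact (WithTop.add_le_add_iff_right hfin).mp key

/-- `length_torsion_quotient_add_finrank_le` for `L = span T`, with the divisibility hypothesis
checked on the generators `T` only. [folklore] -/
theorem length_torsion_quotient_add_finrank_le_of_span (hπ : Irreducible π) (D : F →ₗ[S] F')
    (hD : Function.Injective D) (hDπ : ∀ y : F', ∃ x : F, D x = π • y) (T : Set F)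
    {ι : Type w} [Fintype ι] (v : ι → F') (s₂ : Set F')
    (h₁ : ∀ i, π • v i ∈ (span S T).map D) (h₂ : ∀ x ∈ s₂, (π * π) • x ∈ (span S T).map D)
    (hT : ∀ x ∈ T, ∃ y₁ ∈ span S (Set.range v), ∃ y₂ ∈ span S s₂,
      D x = π • y₁ + (π * π) • y₂) :
    Module.length S (torsion S (F' ⧸ (span S (Set.range v) ⊔ span S s₂))) +
        Module.finrank S (span S T)
      ≤ Module.length S (torsion S (F ⧸ span S T)) + Fintype.card ι := by
  refine length_torsion_quotient_add_finrank_le hπ D hD hDπ (span S T) v s₂ h₁ h₂ ?_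
  intro x hx
  induction hx using Submodule.span_induction with
  | mem x hx => exact hT x hx
  | zero => exact ⟨0, zero_mem _, 0, zero_mem _, by simp⟩
  | add x y _ _ hx hy =>
    obtain ⟨x₁, hx₁, x₂, hx₂, ex⟩ := hx
    obtain ⟨y₁, hy₁, y₂, hy₂, ey⟩ := hy
    exact ⟨x₁ + y₁, add_mem hx₁ hy₁, x₂ + y₂, add_mem hx₂ hy₂, by
      rw [map_add, ex, ey, smul_add, smul_add]; abel⟩
  | smul c x _ hx =>
    obtain ⟨x₁, hx₁, x₂, hx₂, ex⟩ := hx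
    exact ⟨c • x₁, smul_mem _ _ hx₁, c • x₂, smul_mem _ _ hx₂, by
      rw [map_smul, ex, smul_add, smul_comm c π, smul_comm c (π * π)]⟩

omit [Module.Finite S F] [Module.IsTorsionFree S F'] in
/-- Under the hypotheses of `length_torsion_quotient_add_finrank_le`, `L'` and `L` have the same
rank (`D L ≤ L'` with `L'/D L` torsion, and `D` is injective). [folklore] -/
theorem finrank_span_sup_span_eq (hπ : Irreducible π) (D : F →ₗ[S] F')
    (hD : Function.Injective D) (L : Submodule S F)
    {ι : Type w} (v : ι → F') (s₂ : Set F')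
    (h₁ : ∀ i, π • v i ∈ L.map D) (h₂ : ∀ x ∈ s₂, (π * π) • x ∈ L.map D)
    (hL : ∀ x ∈ L, ∃ y₁ ∈ span S (Set.range v), ∃ y₂ ∈ span S s₂,
      D x = π • y₁ + (π * π) • y₂) :
    Module.finrank S ↥(span S (Set.range v) ⊔ span S s₂) = Module.finrank S L := by
  have hπ0 : π ∈ nonZeroDivisors S := mem_nonZeroDivisors_of_ne_zero hπ.ne_zero
  set L' : Submodule S F' := span S (Set.range v) ⊔ span S s₂
  have hDL_le : L.map D ≤ L' := by
    rintro _ ⟨x, hx, rfl⟩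
    obtain ⟨y₁, hy₁, y₂, hy₂, h⟩ := hL x hx
    rw [h]
    exact add_mem (Submodule.mem_sup_left (Submodule.smul_mem _ _ hy₁))
      (Submodule.mem_sup_right (Submodule.smul_mem _ _ hy₂))
  have htorsL' : ∀ x ∈ L', ∃ c ∈ nonZeroDivisors S, c • x ∈ L.map D := by
    let W : Submodule S F' := (torsion S (F' ⧸ L.map D)).comap (L.map D).mkQ
    have hmemW : ∀ y, y ∈ W ↔ ∃ c ∈ nonZeroDivisors S, c • y ∈ L.map D := by
      intro y
      simp only [W, Submodule.mem_comap, mem_torsion_iff, Submodule.mkQ_apply]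
      constructor
      · rintro ⟨c, hc⟩
        refine ⟨c, c.2, ?_⟩
        rwa [Submonoid.smul_def, ← Submodule.Quotient.mk_smul, Submodule.Quotient.mk_eq_zero] at hc
      · rintro ⟨c, hc, hcx⟩
        refine ⟨⟨c, hc⟩, ?_⟩
        rwa [Submonoid.smul_def, ← Submodule.Quotient.mk_smul, Submodule.Quotient.mk_eq_zero]
    have hle : L' ≤ W := by
      refine sup_le (Submodule.span_le.mpr ?_) (Submodule.span_le.mpr ?_)
      · rintro _ ⟨i, rfl⟩
        exact (hmemW _).mpr ⟨π, hπ0, h₁ i⟩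
      · intro x hx
        exact (hmemW _).mpr ⟨π * π, Submonoid.mul_mem _ hπ0 hπ0, h₂ x hx⟩
    exact fun x hx => (hmemW x).mp (hle hx)
  haveI : Module.Finite S L' := Module.Finite.of_injective L'.subtype L'.injective_subtype
  rw [← finrank_eq_of_le_of_torsion (L.map D) L' hDL_le htorsL',
    (Submodule.equivMapOfInjective D hD L).finrank_eq]

omit [Module.Finite S F] [Module.IsTorsionFree S F'] [Module.Finite S F'] in
/-- A surjection between finite modules of the same rank (over a discrete valuation ring, or any
Noetherian domain) has torsion kernel, so the torsion length can only drop: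
`ℓ(tors M') ≤ ℓ(tors Q)`. [folklore] -/
theorem length_torsion_le_of_surjective_of_finrank_eq {Q : Type v} [AddCommGroup Q]
    [Module S Q] [Module.Finite S Q] {M' : Type v'} [AddCommGroup M'] [Module S M']
    (g : Q →ₗ[S] M') (hg : Function.Surjective g)
    (hrank : Module.finrank S Q = Module.finrank S M') :
    Module.length S (torsion S M') ≤ Module.length S (torsion S Q) := by
  haveI : Module.Finite S M' := Module.Finite.of_surjective g hg
  have hker0 : Module.finrank S (LinearMap.ker g) = 0 := by
    have h := Submodule.finrank_quotient_add_finrank (LinearMap.ker g)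
    rw [(LinearMap.quotKerEquivOfSurjective g hg).finrank_eq] at h
    omega
  have htors : LinearMap.ker g ≤ torsion S Q := by
    intro x hx
    obtain ⟨c, hc⟩ := (Module.finrank_eq_zero_iff_isTorsion.mp hker0) (x := ⟨x, hx⟩)
    exact (mem_torsion_iff x).mpr ⟨c, by simpa using congrArg Subtype.val hc⟩
  rw [length_torsion_eq_add_of_le_torsion _ htors,
    length_torsion_eq (LinearMap.quotKerEquivOfSurjective g hg)]
  exact le_add_self

end Main

end Literature.AlgebraicGeometry.Smoothening
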